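import Mathlib
import Literature.RingTheory.TwoVariableSeries.Basic
import Summits.ResolutionOfSingularities.ResolutionOfSingularities.Theorems.WeightedInvariantLocalWeightedDropMonicDescentLabels
import Summits.ResolutionOfSingularities.ResolutionOfSingularities.Theorems.WeightedInvariantLocalWeightedDropMonicDescentBlowOneLaws
import Summits.ResolutionOfSingularities.ResolutionOfSingularities.Theorems.WeightedInvariantLocalWeightedDropMonicDescentInvariantLaws

/-!
# `WeightedInvariant.LocalWeightedDrop`, sub-stub N4″: the label under the `u₂`-chart point blow-up and under the curve blow-ups (piece T-3b/c)

Crux item stmt-ResolutionOfSingularities-8899 `LocalWeightedDrop` (route `ResolutionOfSingularities/WeightedInvariant`), door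
`WeightedConstruction` stmt-ResolutionOfSingularities-0571.  [OURS · L1 W4.3, chain w43, lead prover; pieces T-3b (CJS Lemma 12.2 / 13.4) and
T-3c (CJS Lemma 12.4) of `N4PRIME-PLAN.md`, companions of `…MonicDescentBlowOneLaws` (T-3a).]

* `u₂`-chart (`blowTwo 2 A₀, blowTwo 1 A₁`): `coeff_blowTwo_phiE`, `exists_of_coeff_blowTwo_ne_zero`, `newtonSet_blowTwo` (exact image under
  `phi P = (P₀, P₀ + P₁ − 2)` of `…InvariantLaws`), `isOdd_blowTwo_iff`, `isVertex_of_isVertex_image_phi`, `wellPrepared_blowTwo`;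
* curve blow-up of `V(y,u₁)` (`divOne 2 A₀, divOne 1 A₁`, all points with `P₀ ≥ 2`): `newtonSet_divOne` (image under `shiftOne`), `isOdd_divOne_iff`,
  `isVertex_of_isVertex_image_shiftOne`, `wellPrepared_divOne`.  (The `V(y,u₂)` case is the mirror image; not in this file.)
-/

set_option linter.dupNamespace false -- mandated namespace of this single-conjunct summit

noncomputable section

namespace Summit.ResolutionOfSingularities.ResolutionOfSingularities.Theorems

namespace MonicDescent

open MvPowerSeries Literature.RingTheory.TwoVariableSeries

variable {k : Type} [Field k]

/-! ## The `u₂`-chart -/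

/-- The exponent map of the `u₂`-chart divided by `u₂^c`: `e ↦ (e₀, e₀ + e₁ − c)`. -/
def phiE (c : ℕ) (e : Fin 2 →₀ ℕ) : Fin 2 →₀ ℕ :=
  Finsupp.single 0 (e 0) + Finsupp.single 1 (e 0 + e 1 - c)

/-- Components of `phiE`. -/
@[simp] theorem phiE_apply_zero (c : ℕ) (e : Fin 2 →₀ ℕ) : phiE c e 0 = e 0 := by simp [phiE]

/-- Components of `phiE`. -/
@[simp] theorem phiE_apply_one (c : ℕ) (e : Fin 2 →₀ ℕ) : phiE c e 1 = e 0 + e 1 - c := by simp [phiE]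

/-- `phiE 2 = phi`. -/
theorem phiE_two_eq_phi (e : Fin 2 →₀ ℕ) : phiE 2 e = phi e :=
  finsupp_fin2_ext (by simp) (by simp)

/-- `phiE c` is injective on exponents with `e₀ + e₁ ≥ c`. -/
theorem phiE_injOn (c : ℕ) {e e' : Fin 2 →₀ ℕ} (he : c ≤ e 0 + e 1) (he' : c ≤ e' 0 + e' 1)
    (h : phiE c e = phiE c e') : e = e' := by
  have h0 := congrArg (fun P => P 0) h
  have h1 := congrArg (fun P => P 1) h
  simp only [phiE_apply_zero, phiE_apply_one] at h0 h1
  exact finsupp_fin2_ext h0 (by omega)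

/-- `phiE` on a doubled exponent. -/
theorem phiE_two_smul (e : Fin 2 →₀ ℕ) (he : 1 ≤ e 0 + e 1) : phiE 2 (2 • e) = 2 • phiE 1 e := by
  refine finsupp_fin2_ext ?_ ?_
  · simp only [phiE_apply_zero, Finsupp.smul_apply, smul_eq_mul]
  · simp only [phiE_apply_one, Finsupp.smul_apply, smul_eq_mul]
    omega

/-- The `u₂`-chart transport is exact on exponents with `e₀ + e₁ ≥ c`. -/
theorem coeff_blowTwo_phiE (c : ℕ) (A : MvPowerSeries (Fin 2) k) (e : Fin 2 →₀ ℕ) (he : c ≤ e 0 + e 1) :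
    coeff (phiE c e) (blowTwo c A) = coeff e A := by
  rw [coeff_blowTwo, if_pos (by simp only [phiE_apply_zero, phiE_apply_one]; omega)]
  have hidx : Finsupp.single 0 (phiE c e 0) + Finsupp.single 1 (phiE c e 1 + c - phiE c e 0) = e := by
    refine finsupp_fin2_ext ?_ ?_
    · simp only [Finsupp.add_apply, Finsupp.single_apply, phiE_apply_zero]
      simp
    · simp only [Finsupp.add_apply, Finsupp.single_apply, phiE_apply_zero, phiE_apply_one]
      simp
      omega
  rw [hidx]

/-- Every exponent of `blowTwo c A` is `phiE c e` for an exponent `e` of `A` with `e₀ + e₁ ≥ c`. -/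
theorem exists_of_coeff_blowTwo_ne_zero (c : ℕ) (A : MvPowerSeries (Fin 2) k) (d : Fin 2 →₀ ℕ)
    (hd : coeff d (blowTwo c A) ≠ 0) :
    ∃ e : Fin 2 →₀ ℕ, c ≤ e 0 + e 1 ∧ d = phiE c e ∧ coeff e A ≠ 0 := by
  rw [coeff_blowTwo] at hd
  split_ifs at hd with hle
  · refine ⟨Finsupp.single 0 (d 0) + Finsupp.single 1 (d 1 + c - d 0), ?_, ?_, hd⟩
    · simp only [Finsupp.add_apply, Finsupp.single_apply]
      simp
      omega
    · refine finsupp_fin2_ext ?_ ?_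
      · simp only [phiE_apply_zero, Finsupp.add_apply, Finsupp.single_apply]
        simp
      · simp only [phiE_apply_one, Finsupp.add_apply, Finsupp.single_apply]
        simp
        omega
  · exact absurd rfl hd

/-- THE SCALED NEWTON SET UNDER THE `u₂`-CHART POINT BLOW-UP is exactly the image under `phi` (CJS Lemma 12.2 / 13.4 (2)). -/
theorem newtonSet_blowTwo (A₀ A₁ : MvPowerSeries (Fin 2) k) (hN : ∀ P ∈ newtonSet A₀ A₁, 2 ≤ P 0 + P 1) :
    newtonSet (blowTwo 2 A₀) (blowTwo 1 A₁) = phi '' newtonSet A₀ A₁ := by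
  ext d
  constructor
  · rintro (hd | ⟨e', rfl, he'⟩)
    · obtain ⟨e, hle, rfl, he⟩ := exists_of_coeff_blowTwo_ne_zero 2 A₀ d hd
      exact ⟨e, Or.inl he, (phiE_two_eq_phi e).symm⟩
    · obtain ⟨e, hle, rfl, he⟩ := exists_of_coeff_blowTwo_ne_zero 1 A₁ e' he'
      refine ⟨2 • e, Or.inr ⟨e, rfl, he⟩, ?_⟩
      rw [← phiE_two_eq_phi, phiE_two_smul e hle]
  · rintro ⟨P, hP, rfl⟩
    have h2 := hN P hP
    rw [← phiE_two_eq_phi]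
    rcases hP with hP | ⟨e, rfl, he⟩
    · left
      change coeff (phiE 2 P) (blowTwo 2 A₀) ≠ 0
      rwa [coeff_blowTwo_phiE 2 A₀ P h2]
    · right
      have h1 : 1 ≤ e 0 + e 1 := by
        simp only [Finsupp.smul_apply, smul_eq_mul] at h2
        omega
      refine ⟨phiE 1 e, phiE_two_smul e h1, ?_⟩
      rwa [coeff_blowTwo_phiE 1 A₁ e h1]

/-- Oddness is transported under the `u₂`-chart. -/
theorem isOdd_blowTwo_iff (A₀ A₁ : MvPowerSeries (Fin 2) k) (hN : ∀ P ∈ newtonSet A₀ A₁, 2 ≤ P 0 + P 1)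
    {P : Fin 2 →₀ ℕ} (hP : P ∈ newtonSet A₀ A₁) :
    IsOdd (blowTwo 2 A₀) (blowTwo 1 A₁) (phi P) ↔ IsOdd A₀ A₁ P := by
  have h2 := hN P hP
  rw [← phiE_two_eq_phi]
  constructor
  · rintro (⟨e', he'eq, he'⟩ | ⟨hc, i, hi⟩)
    · obtain ⟨e, hle, rfl, he⟩ := exists_of_coeff_blowTwo_ne_zero 1 A₁ e' he'
      left
      refine ⟨e, ?_, he⟩
      have hq : phiE 2 P = phiE 2 (2 • e) := by rw [phiE_two_smul e hle]; exact he'eq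
      exact phiE_injOn 2 h2 (by simp only [Finsupp.smul_apply, smul_eq_mul]; omega) hq
    · right
      rw [coeff_blowTwo_phiE 2 A₀ P h2] at hc
      refine ⟨hc, ?_⟩
      have hi2 : i = 0 ∨ i = 1 := by fin_cases i <;> simp
      rcases hi2 with rfl | rfl
      · simp only [phiE_apply_zero] at hi
        exact ⟨0, hi⟩
      · simp only [phiE_apply_one] at hi
        by_cases h0 : 2 ∣ P 0
        · refine ⟨1, fun h1 => hi ?_⟩
          obtain ⟨a, ha⟩ := h0
          obtain ⟨b, hb⟩ := h1
          exact ⟨a + b - 1, by omega⟩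
        · exact ⟨0, h0⟩
  · rintro (⟨e, rfl, he⟩ | ⟨hc, i, hi⟩)
    · left
      have h1 : 1 ≤ e 0 + e 1 := by
        simp only [Finsupp.smul_apply, smul_eq_mul] at h2
        omega
      refine ⟨phiE 1 e, phiE_two_smul e h1, ?_⟩
      rwa [coeff_blowTwo_phiE 1 A₁ e h1]
    · right
      refine ⟨by rw [coeff_blowTwo_phiE 2 A₀ P h2]; exact hc, ?_⟩
      have hi2 : i = 0 ∨ i = 1 := by fin_cases i <;> simp
      rcases hi2 with rfl | rfl
      · exact ⟨0, by simpa using hi⟩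
      · by_cases h0 : 2 ∣ P 0
        · refine ⟨1, fun h1 => hi ?_⟩
          simp only [phiE_apply_one] at h1
          obtain ⟨a, ha⟩ := h0
          obtain ⟨b, hb⟩ := h1
          exact ⟨b + 1 - a, by omega⟩
        · exact ⟨0, by simpa using h0⟩

/-- A vertex of `phi '' N` (weight `(w₀, w₁)`) comes from a vertex of `N` (weight `(w₀ + w₁, w₁)`). -/
theorem isVertex_of_isVertex_image_phi {N : Set (Fin 2 →₀ ℕ)} (hN : ∀ P ∈ N, 2 ≤ P 0 + P 1) {P : Fin 2 →₀ ℕ} (hP : P ∈ N)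
    (hv : IsVertex (phi '' N) (phi P)) : IsVertex N P := by
  obtain ⟨-, w, hw, hmin⟩ := hv
  refine ⟨hP, fun i => if i = 0 then w 0 + w 1 else w 1, fun i => ?_, fun Q hQ hne => ?_⟩
  · fin_cases i
    · exact Nat.add_pos_left (hw 0) _
    · exact hw 1
  have hPs := hN P hP
  have hQs := hN Q hQ
  have hneq : phi Q ≠ phi P := by
    intro h
    apply hne
    rw [← phiE_two_eq_phi, ← phiE_two_eq_phi] at h
    exact phiE_injOn 2 hQs hPs h
  have hlt := hmin (phi Q) ⟨Q, hQ, rfl⟩ hneq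
  have hwt : ∀ R : Fin 2 →₀ ℕ, 2 ≤ R 0 + R 1 →
      Finsupp.weight w (phi R) + 2 * w 1 = Finsupp.weight (fun i : Fin 2 => if i = 0 then w 0 + w 1 else w 1) R := by
    intro R hR
    rw [Finsupp.weight_apply, Finsupp.weight_apply, Finsupp.sum_fintype _ _ (by simp), Finsupp.sum_fintype _ _ (by simp)]
    simp only [Fin.sum_univ_two, smul_eq_mul, phi_apply_zero, phi_apply_one]
    simp
    have : (R 0 + R 1 - 2) * w 1 + 2 * w 1 = (R 0 + R 1) * w 1 := by
      rw [← Nat.add_mul]; congr 1; omega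
    nlinarith [this]
  have := hwt P hPs
  have := hwt Q hQs
  omega

/-- WELL-PREPAREDNESS PERSISTS under the `u₂`-chart point blow-up. -/
theorem wellPrepared_blowTwo (A₀ A₁ : MvPowerSeries (Fin 2) k) (hN : ∀ P ∈ newtonSet A₀ A₁, 2 ≤ P 0 + P 1)
    (hWP : WellPrepared A₀ A₁) : WellPrepared (blowTwo 2 A₀) (blowTwo 1 A₁) := by
  intro Q hQ
  have hQmem : Q ∈ newtonSet (blowTwo 2 A₀) (blowTwo 1 A₁) := hQ.1
  rw [newtonSet_blowTwo A₀ A₁ hN] at hQmem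
  obtain ⟨P, hP, rfl⟩ := hQmem
  rw [isOdd_blowTwo_iff A₀ A₁ hN hP]
  refine hWP P (isVertex_of_isVertex_image_phi hN hP ?_)
  rwa [← newtonSet_blowTwo A₀ A₁ hN]

/-! ## The curve blow-ups -/

/-- Exact transport under `divOne`: the coefficient at `e − (c,0)`. -/
theorem coeff_divOne_shift (c : ℕ) (A : MvPowerSeries (Fin 2) k) (e : Fin 2 →₀ ℕ) (he : c ≤ e 0) :
    coeff (Finsupp.single 0 (e 0 - c) + Finsupp.single 1 (e 1)) (divOne c A) = coeff e A := by
  rw [coeff_divOne]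
  have hidx : Finsupp.single 0 (e 0 - c) + Finsupp.single 1 (e 1) + Finsupp.single 0 c = e := by
    refine finsupp_fin2_ext ?_ ?_
    · simp only [Finsupp.add_apply, Finsupp.single_apply]
      simp
      omega
    · simp only [Finsupp.add_apply, Finsupp.single_apply]
      simp
  rw [hidx]

/-- THE SCALED NEWTON SET UNDER THE BLOW-UP OF `V(y,u₁)` is the image under `shiftOne` (all points with `P₀ ≥ 2`; CJS Lemma 12.4). -/
theorem newtonSet_divOne (A₀ A₁ : MvPowerSeries (Fin 2) k) (hN : ∀ P ∈ newtonSet A₀ A₁, 2 ≤ P 0) :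
    newtonSet (divOne 2 A₀) (divOne 1 A₁) = shiftOne '' newtonSet A₀ A₁ := by
  ext d
  constructor
  · rintro (hd | ⟨e', rfl, he'⟩)
    · change coeff d (divOne 2 A₀) ≠ 0 at hd
      rw [coeff_divOne] at hd
      refine ⟨d + Finsupp.single 0 2, Or.inl hd, finsupp_fin2_ext ?_ ?_⟩
      · simp only [shiftOne_apply_zero, Finsupp.add_apply, Finsupp.single_apply]
        simp
      · simp only [shiftOne_apply_one, Finsupp.add_apply, Finsupp.single_apply]
        simp
    · rw [coeff_divOne] at he'
      refine ⟨2 • (e' + Finsupp.single 0 1), Or.inr ⟨_, rfl, he'⟩, finsupp_fin2_ext ?_ ?_⟩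
      · simp only [shiftOne_apply_zero, Finsupp.smul_apply, Finsupp.add_apply, Finsupp.single_apply, smul_eq_mul]
        simp
        omega
      · simp only [shiftOne_apply_one, Finsupp.smul_apply, Finsupp.add_apply, Finsupp.single_apply, smul_eq_mul]
        simp
  · rintro ⟨P, hP, rfl⟩
    have h2 := hN P hP
    rcases hP with hP | ⟨e, rfl, he⟩
    · left
      change coeff (shiftOne P) (divOne 2 A₀) ≠ 0
      rw [shiftOne]
      rwa [coeff_divOne_shift 2 A₀ P h2]
    · right
      have h1 : 1 ≤ e 0 := by
        simp only [Finsupp.smul_apply, smul_eq_mul] at h2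
        omega
      refine ⟨Finsupp.single 0 (e 0 - 1) + Finsupp.single 1 (e 1), finsupp_fin2_ext ?_ ?_, ?_⟩
      · simp only [shiftOne_apply_zero, Finsupp.smul_apply, Finsupp.add_apply, Finsupp.single_apply, smul_eq_mul]
        simp
        omega
      · simp only [shiftOne_apply_one, Finsupp.smul_apply, Finsupp.add_apply, Finsupp.single_apply, smul_eq_mul]
        simp
      · rwa [coeff_divOne_shift 1 A₁ e h1]

/-- Oddness is transported under the blow-up of `V(y,u₁)`. -/
theorem isOdd_divOne_iff (A₀ A₁ : MvPowerSeries (Fin 2) k) (hN : ∀ P ∈ newtonSet A₀ A₁, 2 ≤ P 0)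
    {P : Fin 2 →₀ ℕ} (hP : P ∈ newtonSet A₀ A₁) :
    IsOdd (divOne 2 A₀) (divOne 1 A₁) (shiftOne P) ↔ IsOdd A₀ A₁ P := by
  have h2 := hN P hP
  have hshift : shiftOne P = Finsupp.single 0 (P 0 - 2) + Finsupp.single 1 (P 1) := rfl
  constructor
  · rintro (⟨e', he'eq, he'⟩ | ⟨hc, i, hi⟩)
    · left
      rw [coeff_divOne] at he'
      refine ⟨e' + Finsupp.single 0 1, finsupp_fin2_ext ?_ ?_, he'⟩
      · have := congrArg (fun Q => Q 0) he'eq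
        simp only [shiftOne_apply_zero, Finsupp.smul_apply, smul_eq_mul] at this
        simp only [Finsupp.smul_apply, Finsupp.add_apply, Finsupp.single_apply, smul_eq_mul]
        simp
        omega
      · have := congrArg (fun Q => Q 1) he'eq
        simp only [shiftOne_apply_one, Finsupp.smul_apply, smul_eq_mul] at this
        simp only [Finsupp.smul_apply, Finsupp.add_apply, Finsupp.single_apply, smul_eq_mul]
        simp
        omega
    · right
      rw [hshift, coeff_divOne_shift 2 A₀ P h2] at hc
      refine ⟨hc, ?_⟩
      have hi2 : i = 0 ∨ i = 1 := by fin_cases i <;> simp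
      rcases hi2 with rfl | rfl
      · simp only [shiftOne_apply_zero] at hi
        refine ⟨0, fun h0 => hi ?_⟩
        obtain ⟨a, ha⟩ := h0
        exact ⟨a - 1, by omega⟩
      · simp only [shiftOne_apply_one] at hi
        exact ⟨1, hi⟩
  · rintro (⟨e, rfl, he⟩ | ⟨hc, i, hi⟩)
    · left
      have h1 : 1 ≤ e 0 := by
        simp only [Finsupp.smul_apply, smul_eq_mul] at h2
        omega
      refine ⟨Finsupp.single 0 (e 0 - 1) + Finsupp.single 1 (e 1), finsupp_fin2_ext ?_ ?_, ?_⟩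
      · simp only [shiftOne_apply_zero, Finsupp.smul_apply, Finsupp.add_apply, Finsupp.single_apply, smul_eq_mul]
        simp
        omega
      · simp only [shiftOne_apply_one, Finsupp.smul_apply, Finsupp.add_apply, Finsupp.single_apply, smul_eq_mul]
        simp
      · rwa [coeff_divOne_shift 1 A₁ e h1]
    · right
      refine ⟨by rw [hshift, coeff_divOne_shift 2 A₀ P h2]; exact hc, ?_⟩
      have hi2 : i = 0 ∨ i = 1 := by fin_cases i <;> simp
      rcases hi2 with rfl | rfl
      · refine ⟨0, fun h0 => hi ?_⟩
        simp only [shiftOne_apply_zero] at h0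
        obtain ⟨a, ha⟩ := h0
        exact ⟨a + 1, by omega⟩
      · exact ⟨1, by simpa using hi⟩

/-- A vertex of `shiftOne '' N` comes from a vertex of `N` (same weight; all points with `P₀ ≥ 2`). -/
theorem isVertex_of_isVertex_image_shiftOne {N : Set (Fin 2 →₀ ℕ)} (hN : ∀ P ∈ N, 2 ≤ P 0) {P : Fin 2 →₀ ℕ} (hP : P ∈ N)
    (hv : IsVertex (shiftOne '' N) (shiftOne P)) : IsVertex N P := by
  obtain ⟨-, w, hw, hmin⟩ := hv
  refine ⟨hP, w, hw, fun Q hQ hne => ?_⟩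
  have hPs := hN P hP
  have hQs := hN Q hQ
  have hneq : shiftOne Q ≠ shiftOne P := by
    intro h
    apply hne
    have h0 := congrArg (fun R => R 0) h
    have h1 := congrArg (fun R => R 1) h
    simp only [shiftOne_apply_zero, shiftOne_apply_one] at h0 h1
    exact finsupp_fin2_ext (by omega) h1
  have hlt := hmin (shiftOne Q) ⟨Q, hQ, rfl⟩ hneq
  have hwt : ∀ R : Fin 2 →₀ ℕ, 2 ≤ R 0 → Finsupp.weight w (shiftOne R) + 2 * w 0 = Finsupp.weight w R := by
    intro R hR
    rw [Finsupp.weight_apply, Finsupp.weight_apply, Finsupp.sum_fintype _ _ (by simp), Finsupp.sum_fintype _ _ (by simp)]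
    simp only [Fin.sum_univ_two, smul_eq_mul, shiftOne_apply_zero, shiftOne_apply_one]
    have : (R 0 - 2) * w 0 + 2 * w 0 = R 0 * w 0 := by
      rw [← Nat.add_mul]; congr 1; omega
    nlinarith [this]
  have := hwt P hPs
  have := hwt Q hQs
  omega

/-- WELL-PREPAREDNESS PERSISTS under the blow-up of `V(y,u₁)`. -/
theorem wellPrepared_divOne (A₀ A₁ : MvPowerSeries (Fin 2) k) (hN : ∀ P ∈ newtonSet A₀ A₁, 2 ≤ P 0)
    (hWP : WellPrepared A₀ A₁) : WellPrepared (divOne 2 A₀) (divOne 1 A₁) := by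
  intro Q hQ
  have hQmem : Q ∈ newtonSet (divOne 2 A₀) (divOne 1 A₁) := hQ.1
  rw [newtonSet_divOne A₀ A₁ hN] at hQmem
  obtain ⟨P, hP, rfl⟩ := hQmem
  rw [isOdd_divOne_iff A₀ A₁ hN hP]
  refine hWP P (isVertex_of_isVertex_image_shiftOne hN hP ?_)
  rwa [← newtonSet_divOne A₀ A₁ hN]

end MonicDescent

end Summit.ResolutionOfSingularities.ResolutionOfSingularities.Theorems

end
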